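import Literature.Analysis.FluidPDE.TypeIAncientMild
import Literature.Analysis.FluidPDE.TypeIAncientMildClassical
import Literature.Analysis.FluidPDE.AncientSimilarityVariables
import Literature.Analysis.FluidPDE.TsaiSelfSimilarBounded
import Literature.Analysis.FluidPDE.SelfSimilar
import HarnessLib

/-!
# Crux `OddMorawetz.MorawetzKillsTypeI` (stmt-NavierStokesRegularity-1377), line `birth`:
  STUB `stub_selfSimilarRigidity` — self-similar elements of the Oseen-gauge Type-I class vanish

A SELF-SIMILAR element `w` (`IsSelfSimilar w`: `c • w (c² t) (c • x) = w t x` for all `c > 0`) of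
the Oseen-gauge Type-I rate class `IsTypeIAncientMild C w` (jointly smooth on `t < 0`,
divergence-free slices, Oseen–Duhamel integral equation between all pairs `s < t < 0`,
`‖w t x‖ ≤ C/√(−t)`) vanishes identically on `t < 0`.

Proof (all handles in tree).
1. `w` is classical on the window `(−2, 0)` for some smooth pressure `p`
   (`IsTypeIAncientMild.exists_isClassicalNSSolutionOn_Ioo`, Fabes–Jones–Rivière), hence
   `(U, P) = (lerayOrbit w, lerayOrbitPressure p)` solves the backward Leray system on the open
   set `τ⁻¹((−2, 0))` of similarity times, which contains `s = 0` (`τ(0) = −1`)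
   (`isClassicalNSSolutionOn_iff_isBackwardLeraySolutionOn_lerayOrbit`, Chae–Wolf 2017 §4).
2. Self-similarity makes the profile steady, `lerayOrbit w s = w(−1)` (`IsSelfSimilar.lerayOrbit_eq`),
   so `∂ₛU = 0` and Leray's form of the momentum equation at `s = 0` says that
   `(w(−1), P(0))` is a Leray profile `IsLerayProfile 1 (1/2)` (`isLerayProfile_of_isSelfSimilar`).
3. `‖w(−1, y)‖ ≤ C`, so by Tsai 1998, Thm 1 at `q = ∞` (`IsLerayProfile.exists_eq_const_of_bounded`)
   `w(−1) ≡ c`; then every slice is constant, `w t x = (√(−t))⁻¹ • c` (`eq_lerayOrbit_of_neg`), and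
   the Oseen gauge kills slice-constant elements (`IsTypeIAncientMild.eq_zero_of_slice_const`,
   KNSS 2009 Remark 6.1 with the Type-I decay at `−∞`).

Lands `--supports stmt-NavierStokesRegularity-1377`.
-/

noncomputable section

set_option linter.dupNamespace false

namespace Summit.NavierStokesRegularity.NavierStokesRegularity.Theorems

open Set Function
open scoped ContDiff Laplacian
open Literature.Analysis Literature.Analysis.FluidPDE

/-! ### The steady profile of a self-similar Type-I ancient mild field is a Leray profile -/

/-- **The slice `w(−1)` of a self-similar Type-I ancient mild field is a bounded Leray profile
with rate `a = ½` (unit viscosity)**: `w` is classical on `(−2, 0)` for some smooth pressure `p`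
(`IsTypeIAncientMild.exists_isClassicalNSSolutionOn_Ioo`); in backward similarity variables
`(lerayOrbit w, lerayOrbitPressure p)` solves the backward Leray system on `τ⁻¹((−2, 0)) ∋ 0`
(`isClassicalNSSolutionOn_iff_isBackwardLeraySolutionOn_lerayOrbit`); the profile is steady,
`lerayOrbit w s = w(−1)` (`IsSelfSimilar.lerayOrbit_eq`), so `∂ₛU = 0` and Leray's form of the
momentum equation at `s = 0` is the profile equation
`−ΔU + ½U + ½(y·∇)U + (U·∇)U + ∇P = 0` for `U = w(−1)`, `P = lerayOrbitPressure p 0`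
(Leray 1934, (3.11)–(3.12); Lemarié-Rieusset 2016, §16.4: "`U(x) = u(−1, x)`").
[cite: LemarieRieusset2016, §16.4 p. 614] -/
theorem isLerayProfile_of_isSelfSimilar {C : ℝ}
    {w : ℝ → EuclideanSpace ℝ (Fin 3) → EuclideanSpace ℝ (Fin 3)}
    (hw : IsTypeIAncientMild C w) (hss : IsSelfSimilar w) :
    ∃ P : EuclideanSpace ℝ (Fin 3) → ℝ, IsLerayProfile 1 (1 / 2) (w (-1)) P := by
  -- classical on the window `(−2, 0)`
  obtain ⟨p, hcl⟩ := hw.exists_isClassicalNSSolutionOn_Ioo (t₀ := -2) (by norm_num)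
  have hL := (isClassicalNSSolutionOn_iff_isBackwardLeraySolutionOn_lerayOrbit isOpen_Ioo
    Ioo_subset_Iio_self).1 hcl
  set S : Set ℝ := ancientSimTime ⁻¹' Ioo (-2) 0 with hSdef
  have hs : (0 : ℝ) ∈ S := by
    rw [hSdef, mem_preimage, ancientSimTime_apply, mem_Ioo, neg_zero, Real.exp_zero]
    norm_num
  -- Leray's form of the momentum equation at `s = 0`, where the profile is steady
  refine ⟨lerayOrbitPressure p 0, ?_, ?_, fun y => ?_, hw.isDivFree (by norm_num)⟩
  · exact (hw.contDiff_slice (by norm_num)).of_le (by norm_cast)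
  · exact (hL.smooth_pressure.contDiff_slice hs).of_le (by norm_cast)
  · have hm := hL.momentum_leray hs y
    have hD : timeDerivWithin S (lerayOrbit w) 0 y = 0 := by
      simp only [timeDerivWithin_apply, hss.lerayOrbit_eq, derivWithin_fun_const, Pi.zero_apply]
    rw [hD, zero_add, hss.lerayOrbit_eq 0] at hm
    rw [← hm]
    abel

/-! ### The stub -/

/-- **Rigidity — a self-similar element of an Oseen-gauge Type-I rate class vanishes** (stub
`stub_selfSimilarRigidity` of the line `birth` of crux `MorawetzKillsTypeI`). The similarity
profile `U = w(−1, ·)` is a Leray profile `IsLerayProfile 1 (1/2) U P`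
(`isLerayProfile_of_isSelfSimilar`) bounded by `C` (`‖w(−1, y)‖ ≤ C/√1`), hence constant by
Tsai 1998, Theorem 1 at `q = ∞` (`IsLerayProfile.exists_eq_const_of_bounded`, discharged in tree);
so every slice is spatially constant, `w t x = (√(−t))⁻¹ • c` (`eq_lerayOrbit_of_neg`,
`IsSelfSimilar.lerayOrbit_eq`), and the Oseen gauge kills slice-constant elements
(`IsTypeIAncientMild.eq_zero_of_slice_const`: KNSS 2009, Remark 6.1 and the Type-I decay at `−∞`).
Full self-similarity (all `λ > 0`) — not the open `λ`-DSS Liouville problem.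
[cite: Tsai1998, Thm 1 (p. 31)] -/
theorem stub_selfSimilarRigidity :
    ∀ (C : ℝ) (w : ℝ → EuclideanSpace ℝ (Fin 3) → EuclideanSpace ℝ (Fin 3)),
      Literature.Analysis.FluidPDE.IsTypeIAncientMild C w → Literature.Analysis.FluidPDE.IsSelfSimilar w →
      ∀ t < 0, ∀ x, w t x = 0 := by
  intro C w hw hss t ht x
  obtain ⟨P, hprof⟩ := isLerayProfile_of_isSelfSimilar hw hss
  -- Tsai: the bounded profile `w(−1)` is constant
  obtain ⟨c, hc⟩ := hprof.exists_eq_const_of_bounded one_pos (by norm_num)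
    ⟨C / Real.sqrt (-(-1)), fun y => hw.norm_le (by norm_num) y⟩
  -- every slice is spatially constant
  have hub : ∀ t < 0, ∀ x, w t x = (Real.sqrt (-t))⁻¹ • c := fun t ht x => by
    rw [eq_lerayOrbit_of_neg w ht x, hss.lerayOrbit_eq, hc]
  -- the Oseen gauge kills slice-constant elements
  exact hw.eq_zero_of_slice_const (b := fun t => (Real.sqrt (-t))⁻¹ • c) hub ht x

end Summit.NavierStokesRegularity.NavierStokesRegularity.Theorems

end
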